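/-
Copyright (c) 2026 the pub-hodgecm-mathlib formalisation cell (harness21).  Prover seat hodgecm-mathlib-K2E5-p12 (g0), K2-LIT, h413 = `stmt-HodgeConjecture-24833`, unit U3b,
sub-line «U3b-c RANK-ONE GERMS», (ii♭-H): FILE 2 of the rank-one twin of the ‹Ψ-package› (DEAL K2E3-plan (g1), K2/STATUS.md 2026-09-03T23:27:26Z (b)).  2026-09-04.
-/
import Summits.HodgeConjecture.HodgeConjecture.Theorems.K2E3CayleyScalingRankOne    -- ★ FILE 1 (this seat): the ball `B` (`hB`, PAIR version), `isUnit_of_mem_ball`, `ball_isClopen`, `conj_mem_ball_iff`, `ball_smul`, continuity kit, `det_one_sub_add_eq_fin_two`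
import Literature.NumberTheory.Rogawski1990.LocalTransferFundamentalLemma           -- ★ `IsLocSmooth` (`C_c^∞`: locally constant, compact support)
import Literature.LinearAlgebra.Matrix.CharpolyDiscTwinBridge                       -- ★ `isUnit_discr_iff_separable_of_monic`
import HarnessLib

/-!
# h413 ∕ K2-LIT, line `K2_E3_EllipticInputs`, unit U3b, (ii♭-H): THE RANK-ONE CAYLEY SCALING, FILE 2 (`N = 2` twin of ★ `K2E3CayleyScalingMap`) — on the eigenvalue ball of
# `U(σ, J)(K) ≤ GL₂(K)`, `Ψ_s = c ∘ (s·) ∘ c⁻¹` is equivariant, centraliser- and regularity-preserving, contracting, `Ψ^k → 1`, and pulls `C_c^∞` back to `C_c^∞`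

Cell `pub/hodgecm-mathlib`, crux H413 = `stmt-HodgeConjecture-24833`; dealer K2E3-plan (g1), line lead (ii) K2E4-p06 (g2), consult K2E3-p01 (g0).  THEOREMS ONLY (no `def`, no
`instance`, no `notation`, no named-fact hypothesis, no `sorry`); lane `--supports stmt-HodgeConjecture-24833 --as helper` (count-neutral).
DESIGN (as in ★ FILE 1): `K` an ultrametric normed field, `σ`, `J ∈ M₂(K)`, `M = U(σ, J)(K)`, `X_u = (g − 1)(g + 1)⁻¹`; the ball `B` (radius `ρ`) is a variable with
`hB : u ∈ B ↔ det(g + 1) ∈ Kˣ ∧ ‖tr X_u‖ ≤ ρ ∧ ‖det X_u‖ ≤ ρ²`, the scaling a variable `Ψ` with `hΨ : ∀ u ∈ B, mat(Ψ u) = c(s•X_u) ∧ mat((Ψ u)⁻¹) = c(−s•X_u)` (★ FILE 1 `exists_cayleyScaling`).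
RESULTS ([PlatonovRapinchuk1994] §3.3; [HarishChandra1999] §3.1 Lemma 3.2; [Rogawski1990] §8.1 Prop. 8.1.2 (b) p. 114, (8.1.1) p. 116), on `B`, `2 ≠ 0`: §1 the RANK-ONE REGULARITY
KIT — `χ_M` separable ⟺ `tr(M)² − 4·det M ≠ 0` (Mathlib `discr_of_degree_eq_two`, `charpoly_fin_two`, ★ `isUnit_discr_iff_separable_of_monic`), `tr c(X) = (2 − 2 det X)∕det(1 − X)`,
`det c(X) = det(1 + X)∕det(1 − X)`, the Möbius identity `tr(c(X))² − 4 det c(X) = 4·(tr(X)² − 4 det X)∕det(1 − X)²`; §2 (C) `c⁻¹(Ψ u) = s•X_u`, `Ψ u` in every ball of radius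
`≥ ‖s‖ρ`; (E) `x u x⁻¹ ∈ B`, `Ψ(x u x⁻¹) = x Ψ(u) x⁻¹`; (Z) `Z(Ψ u) = Z(u)` (`s ≠ 0`); (R) `χ_{Ψ u}` separable ⟺ `χ_u` separable (`s ≠ 0`); (T) `mat(Ψ^k u) = c(s^k•X_u)`,
`Ψ^k u ∈ B`, `Ψ^k u → 1` (`‖s‖ < 1`); `Ψ|_B` continuous, the `s⁻¹`-scaling is a left inverse; (S) `1_B·(F ∘ Ψ) ∈ C_c^∞` for `F ∈ C_c^∞` (`0 < ρ < 1`, `0 < ‖s‖ ≤ 1`).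
HONEST LABEL.  HC_CM is proved only modulo the 7 printed citations (2 remaining named inputs: hLiu418 = `stmt-HodgeConjecture-24832`, h413 = `stmt-HodgeConjecture-24833`)
until rung 0 closes; this file is a count-neutral helper of the U3b-c sub-line.  REFERENCES: [PlatonovRapinchuk1994] Platonov–Rapinchuk, *Algebraic Groups and Number Theory*
(1994), §3.3 · [HarishChandra1999AdmissibleDistributions] Harish-Chandra, *Admissible Invariant Distributions on Reductive p-adic Groups*, ULS 16 (1999), §3.1 Lemma 3.2 ·
[Rogawski1990] Rogawski, *Automorphic representations of unitary groups in three variables*, AMS 123 (1990), §3.1 p. 19; §8.1 pp. 114, 116 · [BasuPollackRoy2006] Basu–Pollack–Roy (2006), §4.1.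
-/

set_option autoImplicit false
set_option linter.dupNamespace false  -- the mandated namespace repeats the single-problem summit's segment, as in every `Theorems/*.lean` here

noncomputable section

open Filter Topology Polynomial Set
open scoped Matrix MatrixGroups
open Literature.NumberTheory.Automorphic Literature.NumberTheory.Rogawski1990 Literature.NumberTheory.Weil1982.UnitaryFinTopForm Literature.LinearAlgebra.Matrix
open Summit.HodgeConjecture.HodgeConjecture.Cruxes.H413.K2E3CompactCartanRegularRay Summit.HodgeConjecture.HodgeConjecture.Cruxes.H413.K2E3CayleyScalingAlgebra
open Summit.HodgeConjecture.HodgeConjecture.Cruxes.H413.K2E3CayleyScalingRankOne  -- NOT the `N = 3` ★ `K2E3CayleyScalingModel`/`Map` namespaces (same names at `Fin 3`)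

namespace Summit.HodgeConjecture.HodgeConjecture.Cruxes.H413.K2E3CayleyScalingRankOneMap

section Regularity

variable {F : Type*} [Field F]

/-- **`χ_M` is separable iff `tr(M)² − 4·det M ≠ 0`** for a `2 × 2` matrix over a field (`χ_M = T² − tr M·T + det M`, Mathlib `Matrix.charpoly_fin_two`; a monic polynomial is
separable iff its discriminant is a unit, ★ `isUnit_discr_iff_separable_of_monic`; Mathlib `Polynomial.discr_of_degree_eq_two`). [cite: BasuPollackRoy2006, §4.1 Prop. 4.3] -/
theorem separable_charpoly_iff_fin_two (M : Matrix (Fin 2) (Fin 2) F) : M.charpoly.Separable ↔ M.trace ^ 2 - 4 * M.det ≠ 0 := by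
  rw [← isUnit_discr_iff_separable_of_monic (Matrix.charpoly_monic M), isUnit_iff_ne_zero]
  have hdeg : M.charpoly.degree = 2 := by rw [Matrix.charpoly_degree_eq_dim, Fintype.card_fin]; rfl
  have hc : M.charpoly.coeff 0 = M.det ∧ M.charpoly.coeff 1 = -M.trace ∧ M.charpoly.coeff 2 = 1 := by
    rw [Matrix.charpoly_fin_two]
    simp only [coeff_add, coeff_sub, coeff_X_pow, coeff_C_mul, coeff_X, coeff_C]
    norm_num
  rw [Polynomial.discr_of_degree_eq_two hdeg, hc.1, hc.2.1, hc.2.2]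
  have h : (-M.trace) ^ 2 - 4 * M.det * 1 = M.trace ^ 2 - 4 * M.det := by ring
  rw [h]

/-- **Scaling by a non-zero scalar preserves separability of `χ`** (`2 × 2`, field): `tr(t•M)² − 4·det(t•M) = t²·(tr(M)² − 4·det M)`. [cite: BasuPollackRoy2006, §4.1 Prop. 4.3] -/
theorem separable_charpoly_smul_iff_fin_two {t : F} (ht : t ≠ 0) (M : Matrix (Fin 2) (Fin 2) F) :
    (t • M).charpoly.Separable ↔ M.charpoly.Separable := by
  obtain ⟨h1, h2⟩ := trace_smul_det_smul_fin_two t M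
  have h : (t • M).trace ^ 2 - 4 * (t • M).det = t ^ 2 * (M.trace ^ 2 - 4 * M.det) := by rw [h1, h2]; ring
  rw [separable_charpoly_iff_fin_two, separable_charpoly_iff_fin_two, h, mul_ne_zero_iff, and_iff_right (pow_ne_zero 2 ht)]

/-- **`tr c(X) = (2 − 2 det X)∕det(1 − X)`, `det c(X) = det(1 + X)∕det(1 − X)`** (`2 × 2`, `det(1 − X) ≠ 0`; `(1 + X)·adj(1 − X) = 2·adj(1 − X) − det(1 − X)·1`, `tr adj = tr`).
[cite: PlatonovRapinchuk1994, §3.3] -/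
theorem trace_det_cayley_fin_two {X : Matrix (Fin 2) (Fin 2) F} (hm : (1 - X).det ≠ 0) :
    (cayley X).trace = (2 - 2 * X.det) / (1 - X).det ∧ (cayley X).det = (1 + X).det / (1 - X).det := by
  have hinv : (1 - X)⁻¹ = ((1 - X).det)⁻¹ • (1 - X).adjugate := by rw [Matrix.inv_def, Ring.inverse_eq_inv]
  obtain ⟨hsub, hadd⟩ := det_one_sub_add_eq_fin_two X
  constructor
  · have hprod : (1 + X) * (1 - X).adjugate = (2 : F) • (1 - X).adjugate - (1 - X).det • (1 : Matrix (Fin 2) (Fin 2) F) := by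
      have h1X : (1 + X : Matrix (Fin 2) (Fin 2) F) = (2 : F) • 1 - (1 - X) := by
        rw [two_smul]; abel
      rw [h1X, Matrix.sub_mul, Matrix.smul_mul, Matrix.one_mul, Matrix.mul_adjugate]
    have hadj : (1 - X).adjugate.trace = (1 - X).trace := by rw [Matrix.adjugate_fin_two, Matrix.trace_fin_two_of, Matrix.trace_fin_two, add_comm]
    rw [cayley_def, hinv, Matrix.mul_smul, hprod, Matrix.trace_smul, Matrix.trace_sub, Matrix.trace_smul, Matrix.trace_smul, hadj,
      Matrix.trace_sub, Matrix.trace_one, Fintype.card_fin, hsub, smul_eq_mul, smul_eq_mul, smul_eq_mul]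
    rw [hsub] at hm
    field_simp
    push_cast
    ring
  · rw [cayley_def, hinv, Matrix.mul_smul, Matrix.det_smul, Matrix.det_mul, Matrix.det_adjugate, Fintype.card_fin]
    rw [hsub] at hm ⊢
    rw [hadd]
    field_simp
    ring

/-- **Möbius identity**: `tr(c(X))² − 4·det c(X) = 4·(tr(X)² − 4·det X)∕det(1 − X)²` (`2 × 2`, `det(1 − X) ≠ 0`). [cite: PlatonovRapinchuk1994, §3.3] [cite: BasuPollackRoy2006, §4.1] -/
theorem trace_sq_sub_four_det_cayley {X : Matrix (Fin 2) (Fin 2) F} (hm : (1 - X).det ≠ 0) :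
    (cayley X).trace ^ 2 - 4 * (cayley X).det = 4 * (X.trace ^ 2 - 4 * X.det) / (1 - X).det ^ 2 := by
  obtain ⟨htr, hdet⟩ := trace_det_cayley_fin_two hm
  obtain ⟨hsub, hadd⟩ := det_one_sub_add_eq_fin_two X
  rw [htr, hdet, hadd, hsub]
  rw [hsub] at hm
  field_simp
  ring

/-- **`χ_{c(X)}` separable ⟺ `χ_X` separable** (`2 × 2`, field, `2 ≠ 0`, `det(1 − X) ≠ 0`). [cite: PlatonovRapinchuk1994, §3.3] [cite: Rogawski1990, §3.1 p. 19] -/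
theorem separable_charpoly_cayley_iff_fin_two (h2 : (2 : F) ≠ 0) {X : Matrix (Fin 2) (Fin 2) F} (hm : (1 - X).det ≠ 0) :
    (cayley X).charpoly.Separable ↔ X.charpoly.Separable := by
  have h4 : (4 : F) ≠ 0 := by rw [show (4 : F) = 2 ^ 2 by norm_num]; exact pow_ne_zero 2 h2
  rw [separable_charpoly_iff_fin_two, separable_charpoly_iff_fin_two, trace_sq_sub_four_det_cayley hm, div_ne_zero_iff, mul_ne_zero_iff,
    and_iff_right h4, and_iff_left (pow_ne_zero 2 hm)]

end Regularity

section Model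

variable {K : Type*} [NormedField K] [IsUltrametricDist K] (σ : K →+* K) (J : Matrix (Fin 2) (Fin 2) K) {ρ : ℝ} {s : K}
  {B : Set ↥(unitaryGroupOfForm σ J)}
  (hB : ∀ u : ↥(unitaryGroupOfForm σ J), u ∈ B ↔
    IsUnit (((u : GL (Fin 2) K) : Matrix (Fin 2) (Fin 2) K) + 1).det ∧
    ‖((((u : GL (Fin 2) K) : Matrix (Fin 2) (Fin 2) K) - 1) * (((u : GL (Fin 2) K) : Matrix (Fin 2) (Fin 2) K) + 1)⁻¹).trace‖ ≤ ρ ∧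
    ‖((((u : GL (Fin 2) K) : Matrix (Fin 2) (Fin 2) K) - 1) * (((u : GL (Fin 2) K) : Matrix (Fin 2) (Fin 2) K) + 1)⁻¹).det‖ ≤ ρ ^ 2)
  {Ψ : ↥(unitaryGroupOfForm σ J) → ↥(unitaryGroupOfForm σ J)}
  (hΨ : ∀ u ∈ B,
    (((Ψ u : ↥(unitaryGroupOfForm σ J)) : GL (Fin 2) K) : Matrix (Fin 2) (Fin 2) K) =
        cayley (s • ((((u : GL (Fin 2) K) : Matrix (Fin 2) (Fin 2) K) - 1) * (((u : GL (Fin 2) K) : Matrix (Fin 2) (Fin 2) K) + 1)⁻¹)) ∧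
    ((((Ψ u : ↥(unitaryGroupOfForm σ J)) : GL (Fin 2) K)⁻¹ : GL (Fin 2) K) : Matrix (Fin 2) (Fin 2) K) =
        cayley (-(s • ((((u : GL (Fin 2) K) : Matrix (Fin 2) (Fin 2) K) - 1) * (((u : GL (Fin 2) K) : Matrix (Fin 2) (Fin 2) K) + 1)⁻¹))))

omit [IsUltrametricDist K] in
/-- Matrices of products in `U(σ, J)(K)` (any size). [folklore] -/
theorem coe_mul_coe {n : Type*} [Fintype n] [DecidableEq n] {J' : Matrix n n K} (x y : ↥(unitaryGroupOfForm σ J')) :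
    (((x * y : ↥(unitaryGroupOfForm σ J')) : GL n K) : Matrix n n K) = ((x : GL n K) : Matrix n n K) * ((y : GL n K) : Matrix n n K) := by
  simp only [Subgroup.coe_mul, Units.val_mul]

omit [IsUltrametricDist K] in
/-- Matrices of conjugates in `U(σ, J)(K)` (any size). [folklore] -/
theorem coe_conj {n : Type*} [Fintype n] [DecidableEq n] {J' : Matrix n n K} (x u : ↥(unitaryGroupOfForm σ J')) :
    (((x * u * x⁻¹ : ↥(unitaryGroupOfForm σ J')) : GL n K) : Matrix n n K) =
      ((x : GL n K) : Matrix n n K) * ((u : GL n K) : Matrix n n K) * (((x : GL n K)⁻¹ : GL n K) : Matrix n n K) := by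
  simp only [Subgroup.coe_mul, Subgroup.coe_inv, Units.val_mul]

omit [IsUltrametricDist K] in
/-- Two elements of `U(σ, J)(K)` commute iff their matrices do (any size). [folklore] -/
theorem commute_iff_coe {n : Type*} [Fintype n] [DecidableEq n] {J' : Matrix n n K} (z u : ↥(unitaryGroupOfForm σ J')) :
    z * u = u * z ↔ ((z : GL n K) : Matrix n n K) * ((u : GL n K) : Matrix n n K) = ((u : GL n K) : Matrix n n K) * ((z : GL n K) : Matrix n n K) := by
  rw [← coe_mul_coe, ← coe_mul_coe]
  exact ⟨fun h => by rw [h], fun h => Subtype.ext (Units.ext h)⟩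

include hB hΨ in
/-- **`c⁻¹(Ψ u) = s • X_u`** with `det(Ψ u + 1)` a unit (`Ψ u = c(s•X_u)`; ★ `inverseWindow_cayley`, ★ `isUnit_det_cayley_add_one`). [cite: PlatonovRapinchuk1994, §3.3] -/
theorem inverseWindow_cayleyScaling (h2 : (2 : K) ≠ 0) (hsρ : ‖s‖ * ρ < 1) {u : ↥(unitaryGroupOfForm σ J)} (hu : u ∈ B) :
    IsUnit ((((Ψ u : ↥(unitaryGroupOfForm σ J)) : GL (Fin 2) K) : Matrix (Fin 2) (Fin 2) K) + 1).det ∧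
    ((((Ψ u : ↥(unitaryGroupOfForm σ J)) : GL (Fin 2) K) : Matrix (Fin 2) (Fin 2) K) - 1) * ((((Ψ u : ↥(unitaryGroupOfForm σ J)) : GL (Fin 2) K) : Matrix (Fin 2) (Fin 2) K) + 1)⁻¹ =
      s • ((((u : GL (Fin 2) K) : Matrix (Fin 2) (Fin 2) K) - 1) * (((u : GL (Fin 2) K) : Matrix (Fin 2) (Fin 2) K) + 1)⁻¹) := by
  obtain ⟨-, hm, -⟩ := isUnit_of_mem_ball σ J hB hsρ hu
  have h2u : IsUnit (2 : K) := isUnit_iff_ne_zero.2 h2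
  rw [(hΨ u hu).1]
  exact ⟨isUnit_det_cayley_add_one h2u hm, inverseWindow_cayley h2u hm⟩

include hB hΨ in
/-- **(C) `Ψ u` lies in every eigenvalue ball of radius `ρ′ ≥ ‖s‖ρ`** (with `ρ′ = ρ`, `‖s‖ ≤ 1`: `Ψ B ⊆ B`). [cite: HarishChandra1999AdmissibleDistributions, §3.1 Lemma 3.2] -/
theorem cayleyScaling_mem_of_ball (h2 : (2 : K) ≠ 0) (hsρ : ‖s‖ * ρ < 1) {ρ' : ℝ} (hρ' : ‖s‖ * ρ ≤ ρ')
    {B' : Set ↥(unitaryGroupOfForm σ J)}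
    (hB' : ∀ u : ↥(unitaryGroupOfForm σ J), u ∈ B' ↔
      IsUnit (((u : GL (Fin 2) K) : Matrix (Fin 2) (Fin 2) K) + 1).det ∧
      ‖((((u : GL (Fin 2) K) : Matrix (Fin 2) (Fin 2) K) - 1) * (((u : GL (Fin 2) K) : Matrix (Fin 2) (Fin 2) K) + 1)⁻¹).trace‖ ≤ ρ' ∧
      ‖((((u : GL (Fin 2) K) : Matrix (Fin 2) (Fin 2) K) - 1) * (((u : GL (Fin 2) K) : Matrix (Fin 2) (Fin 2) K) + 1)⁻¹).det‖ ≤ ρ' ^ 2)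
    {u : ↥(unitaryGroupOfForm σ J)} (hu : u ∈ B) : Ψ u ∈ B' := by
  obtain ⟨hP', hX'⟩ := inverseWindow_cayleyScaling σ J hB hΨ h2 hsρ hu
  obtain ⟨-, ht, hd⟩ := (hB u).1 hu
  obtain ⟨et, ed⟩ := ball_smul s ht hd
  have h0 : 0 ≤ ‖s‖ * ρ := mul_nonneg (norm_nonneg _) ((norm_nonneg _).trans ht)
  rw [hB', hX']
  exact ⟨hP', et.trans hρ', ed.trans (pow_le_pow_left₀ h0 hρ' 2)⟩

include hB hΨ in
/-- `Ψ(x u x⁻¹) = x Ψ(u) x⁻¹` for `u ∈ B` (★ `inverseWindow_conj`, ★ `cayley_conj`; `B` is Ad-stable, ★ FILE 1 `conj_mem_ball_iff`). [cite: PlatonovRapinchuk1994, §3.3] -/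
private theorem cayleyScaling_conj_aux (hsρ : ‖s‖ * ρ < 1) {u : ↥(unitaryGroupOfForm σ J)} (hu : u ∈ B) (x : ↥(unitaryGroupOfForm σ J)) :
    Ψ (x * u * x⁻¹) = x * Ψ u * x⁻¹ := by
  have hxu : x * u * x⁻¹ ∈ B := (conj_mem_ball_iff σ J hB u x).2 hu
  obtain ⟨hP, hm, -⟩ := isUnit_of_mem_ball σ J hB hsρ hu
  apply Subtype.ext; apply Units.ext
  rw [(hΨ _ hxu).1, coe_conj, coe_conj, inverseWindow_conj (x : GL (Fin 2) K) hP, (hΨ u hu).1, ← cayley_conj (x : GL (Fin 2) K) hm, Matrix.mul_smul,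
    Matrix.smul_mul]

include hB hΨ in
/-- **(E) EQUIVARIANCE on the Ad-stable ball**: for `u ∈ B` and `x ∈ U(σ, J)(K)`, `x u x⁻¹ ∈ B` and `Ψ(x u x⁻¹) = x Ψ(u) x⁻¹` (★ `inverseWindow_conj`, ★ `cayley_conj`, ★ FILE 1
`conj_mem_ball_iff`). [cite: PlatonovRapinchuk1994, §3.3] -/
theorem cayleyScaling_conj_mem (hsρ : ‖s‖ * ρ < 1) {u : ↥(unitaryGroupOfForm σ J)} (hu : u ∈ B) (x : ↥(unitaryGroupOfForm σ J)) :
    x * u * x⁻¹ ∈ B ∧ Ψ (x * u * x⁻¹) = x * Ψ u * x⁻¹ :=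
  ⟨(conj_mem_ball_iff σ J hB u x).2 hu, cayleyScaling_conj_aux σ J hB hΨ hsρ hu x⟩

include hB hΨ in
/-- `z u = u z ⟺ z Ψ(u) = Ψ(u) z` on `B` (★ `inverseWindow_comm_of_comm`, ★ `cayley_comm_of_comm`, ★ `inverseWindow_cayley`, `s ≠ 0`). [cite: PlatonovRapinchuk1994, §3.3] -/
private theorem comm_iff_comm_cayleyScaling_aux (h2 : (2 : K) ≠ 0) (hs0 : s ≠ 0) (hsρ : ‖s‖ * ρ < 1) {u : ↥(unitaryGroupOfForm σ J)} (hu : u ∈ B)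
    (z : ↥(unitaryGroupOfForm σ J)) : z * u = u * z ↔ z * Ψ u = Ψ u * z := by
  obtain ⟨hP, hm, -⟩ := isUnit_of_mem_ball σ J hB hsρ hu
  have h2u : IsUnit (2 : K) := isUnit_iff_ne_zero.2 h2
  obtain ⟨hm₀, hcay₀⟩ := cayley_inverseWindow h2u hP
  set g := ((u : GL (Fin 2) K) : Matrix (Fin 2) (Fin 2) K) with hg
  set Z := ((z : GL (Fin 2) K) : Matrix (Fin 2) (Fin 2) K) with hZ
  set X₀ := (g - 1) * (g + 1)⁻¹ with hX₀
  rw [commute_iff_coe, commute_iff_coe, (hΨ u hu).1]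
  constructor
  · intro hzg
    have hX : X₀ * Z = Z * X₀ := inverseWindow_comm_of_comm hP hzg.symm
    have hsX : s • X₀ * Z = Z * (s • X₀) := by rw [Matrix.smul_mul, Matrix.mul_smul, hX]
    exact (cayley_comm_of_comm hm hsX).symm
  · intro hzc
    have hP' : IsUnit (cayley (s • X₀) + 1).det := isUnit_det_cayley_add_one h2u hm
    have h1 := inverseWindow_comm_of_comm hP' hzc.symm
    rw [inverseWindow_cayley h2u hm, Matrix.smul_mul, Matrix.mul_smul] at h1
    have hX : X₀ * Z = Z * X₀ := smul_right_injective (Matrix (Fin 2) (Fin 2) K) hs0 h1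
    have h3 := cayley_comm_of_comm hm₀ hX
    rw [hcay₀] at h3
    exact h3.symm

include hB hΨ in
/-- **(Z) CENTRALISERS: `Z(Ψ u) = Z(u)`** for `u ∈ B` (`s ≠ 0`, `2 ≠ 0`) — pointwise (`z u = u z ⟺ z Ψ(u) = Ψ(u) z`) and as subgroups of `U(σ, J)(K)`.
[cite: PlatonovRapinchuk1994, §3.3] [cite: Rogawski1990, §3.1 p. 19] -/
theorem centralizer_cayleyScaling_eq (h2 : (2 : K) ≠ 0) (hs0 : s ≠ 0) (hsρ : ‖s‖ * ρ < 1) {u : ↥(unitaryGroupOfForm σ J)} (hu : u ∈ B) :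
    (∀ z : ↥(unitaryGroupOfForm σ J), z * u = u * z ↔ z * Ψ u = Ψ u * z) ∧
      Subgroup.centralizer ({Ψ u} : Set ↥(unitaryGroupOfForm σ J)) = Subgroup.centralizer ({u} : Set ↥(unitaryGroupOfForm σ J)) := by
  have h := fun z => comm_iff_comm_cayleyScaling_aux σ J hB hΨ h2 hs0 hsρ hu z
  refine ⟨h, Subgroup.ext fun z => ?_⟩
  rw [Subgroup.mem_centralizer_singleton_iff, Subgroup.mem_centralizer_singleton_iff]
  exact (h z).symm

include hB hΨ in
/-- **(R) `χ_{Ψ u}` is separable iff `χ_u` is** (`u ∈ B`, `s ≠ 0`, `2 ≠ 0`): `Ψ u = c(s•X_u)`, `u = c(X_u)`, and separability passes through `c` and through `s•` (§1).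
[cite: Rogawski1990, §3.1 p. 19] [cite: PlatonovRapinchuk1994, §3.3] -/
theorem separable_charpoly_cayleyScaling_iff (h2 : (2 : K) ≠ 0) (hs0 : s ≠ 0) (hsρ : ‖s‖ * ρ < 1) {u : ↥(unitaryGroupOfForm σ J)} (hu : u ∈ B) :
    ((((Ψ u : ↥(unitaryGroupOfForm σ J)) : GL (Fin 2) K) : Matrix (Fin 2) (Fin 2) K)).charpoly.Separable ↔
      (((u : GL (Fin 2) K) : Matrix (Fin 2) (Fin 2) K)).charpoly.Separable := by
  obtain ⟨hP, hm, -⟩ := isUnit_of_mem_ball σ J hB hsρ hu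
  have h2u : IsUnit (2 : K) := isUnit_iff_ne_zero.2 h2
  obtain ⟨hm₀, hcay₀⟩ := cayley_inverseWindow h2u hP
  rw [(hΨ u hu).1, separable_charpoly_cayley_iff_fin_two h2 hm.ne_zero, separable_charpoly_smul_iff_fin_two hs0]
  conv_rhs => rw [← hcay₀]
  rw [separable_charpoly_cayley_iff_fin_two h2 hm₀.ne_zero]

include hB hΨ in
/-- **The iterates of `Ψ` on `B`**: `Ψ^k u ∈ B`, `mat(Ψ^k u) = c(s^k•X_u)`, `mat((Ψ^k u)⁻¹) = c(−s^k•X_u)` (`‖s‖ ≤ 1`, `ρ < 1`, `2 ≠ 0`). [cite: HarishChandra1999AdmissibleDistributions, §3.1 Lemma 3.2] -/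
theorem iterate_cayleyScaling (h2 : (2 : K) ≠ 0) (hs1 : ‖s‖ ≤ 1) (hρ : ρ < 1) {u : ↥(unitaryGroupOfForm σ J)} (hu : u ∈ B) (k : ℕ) :
    Ψ^[k] u ∈ B ∧
    (((Ψ^[k] u : ↥(unitaryGroupOfForm σ J)) : GL (Fin 2) K) : Matrix (Fin 2) (Fin 2) K) =
        cayley (s ^ k • ((((u : GL (Fin 2) K) : Matrix (Fin 2) (Fin 2) K) - 1) * (((u : GL (Fin 2) K) : Matrix (Fin 2) (Fin 2) K) + 1)⁻¹)) ∧
    ((((Ψ^[k] u : ↥(unitaryGroupOfForm σ J)) : GL (Fin 2) K)⁻¹ : GL (Fin 2) K) : Matrix (Fin 2) (Fin 2) K) =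
        cayley (-(s ^ k • ((((u : GL (Fin 2) K) : Matrix (Fin 2) (Fin 2) K) - 1) * (((u : GL (Fin 2) K) : Matrix (Fin 2) (Fin 2) K) + 1)⁻¹))) := by
  have hρ0 : 0 ≤ ρ := by obtain ⟨-, ht, -⟩ := (hB u).1 hu; exact (norm_nonneg _).trans ht
  have hsρ : ‖s‖ * ρ < 1 := lt_of_le_of_lt (mul_le_of_le_one_left hρ0 hs1) hρ
  have h2u : IsUnit (2 : K) := isUnit_iff_ne_zero.2 h2
  induction k with
  | zero =>
    obtain ⟨hP, hm1, hp1⟩ := isUnit_of_mem_ball σ J hB (s := (1 : K)) (by rw [norm_one, one_mul]; exact hρ) hu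
    rw [one_smul] at hm1 hp1
    obtain ⟨-, hcay₀⟩ := cayley_inverseWindow h2u hP
    refine ⟨hu, ?_, ?_⟩
    · rw [Function.iterate_zero_apply, pow_zero, one_smul]
      exact hcay₀.symm
    · rw [Function.iterate_zero_apply, pow_zero, one_smul, Matrix.coe_units_inv]
      conv_lhs => rw [← hcay₀]
      exact Matrix.inv_eq_right_inv (cayley_mul_cayley_neg hm1 hp1)
  | succ k ih =>
    obtain ⟨hk, hmat, -⟩ := ih
    have hsk : ‖s ^ k‖ * ρ < 1 := lt_of_le_of_lt (mul_le_of_le_one_left hρ0 (by rw [norm_pow]; exact pow_le_one₀ (norm_nonneg _) hs1)) hρ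
    obtain ⟨-, hmk, -⟩ := isUnit_of_mem_ball σ J hB hsk hu
    have hXk : ((((Ψ^[k] u : ↥(unitaryGroupOfForm σ J)) : GL (Fin 2) K) : Matrix (Fin 2) (Fin 2) K) - 1) *
        ((((Ψ^[k] u : ↥(unitaryGroupOfForm σ J)) : GL (Fin 2) K) : Matrix (Fin 2) (Fin 2) K) + 1)⁻¹ =
        s ^ k • ((((u : GL (Fin 2) K) : Matrix (Fin 2) (Fin 2) K) - 1) * (((u : GL (Fin 2) K) : Matrix (Fin 2) (Fin 2) K) + 1)⁻¹) := by
      rw [hmat]; exact inverseWindow_cayley h2u hmk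
    rw [Function.iterate_succ_apply']
    refine ⟨cayleyScaling_mem_of_ball σ J hB hΨ h2 hsρ (mul_le_of_le_one_left hρ0 hs1) hB hk, ?_, ?_⟩
    · rw [(hΨ _ hk).1, hXk, smul_smul, ← pow_succ']
    · rw [(hΨ _ hk).2, hXk, smul_smul, ← pow_succ']

include hB hΨ in
/-- `Ψ^k u → 1` for `u ∈ B` (`‖s‖ < 1`): `c(±s^k•X_u) → 1`, read through `g ↦ (g, g⁻¹)`. [cite: Rogawski1990, §8.1 (8.1.1) p. 116] -/
private theorem tendsto_iterate_cayleyScaling_aux (h2 : (2 : K) ≠ 0) (hs1 : ‖s‖ < 1) (hρ : ρ < 1) {u : ↥(unitaryGroupOfForm σ J)} (hu : u ∈ B) :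
    Tendsto (fun k : ℕ => Ψ^[k] u) atTop (𝓝 1) := by
  set X₀ := ((((u : GL (Fin 2) K) : Matrix (Fin 2) (Fin 2) K) - 1) * (((u : GL (Fin 2) K) : Matrix (Fin 2) (Fin 2) K) + 1)⁻¹) with hX₀
  have hiter := fun k => iterate_cayleyScaling σ J hB hΨ h2 hs1.le hρ hu k
  have hY : Tendsto (fun k : ℕ => s ^ k • X₀) atTop (𝓝 0) := by
    simpa using (tendsto_pow_atTop_nhds_zero_of_norm_lt_one hs1).smul (tendsto_const_nhds (x := X₀))
  have hcay : Tendsto (fun k : ℕ => cayley (s ^ k • X₀)) atTop (𝓝 1) := by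
    have ha : Tendsto (fun k : ℕ => 1 + s ^ k • X₀) atTop (𝓝 1) := by simpa using tendsto_const_nhds.add hY
    have hb : Tendsto (fun k : ℕ => (1 - s ^ k • X₀)⁻¹) atTop (𝓝 1) := tendsto_inv_of_tendsto_one (by simpa using tendsto_const_nhds.sub hY)
    simpa [cayley_def] using ha.mul hb
  have hcay' : Tendsto (fun k : ℕ => cayley (-(s ^ k • X₀))) atTop (𝓝 1) := by
    have ha : Tendsto (fun k : ℕ => 1 + -(s ^ k • X₀)) atTop (𝓝 1) := by simpa using tendsto_const_nhds.add hY.neg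
    have hb : Tendsto (fun k : ℕ => (1 - -(s ^ k • X₀))⁻¹) atTop (𝓝 1) := tendsto_inv_of_tendsto_one (by simpa using tendsto_const_nhds.sub hY.neg)
    simpa [cayley_def] using ha.mul hb
  rw [tendsto_subtype_rng, Units.isEmbedding_embedProduct.isInducing.tendsto_nhds_iff]
  have h1 : Units.embedProduct (Matrix (Fin 2) (Fin 2) K) ((1 : ↥(unitaryGroupOfForm σ J)) : GL (Fin 2) K) =
      ((1 : Matrix (Fin 2) (Fin 2) K), MulOpposite.op (1 : Matrix (Fin 2) (Fin 2) K)) := by simp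
  rw [h1]
  refine (hcay.prodMk_nhds ((MulOpposite.continuous_op.tendsto 1).comp hcay')).congr' (Eventually.of_forall fun k => ?_)
  show (cayley (s ^ k • X₀), MulOpposite.op (cayley (-(s ^ k • X₀)))) = Units.embedProduct _ ((Ψ^[k] u : ↥(unitaryGroupOfForm σ J)) : GL (Fin 2) K)
  rw [Units.embedProduct_apply, (hiter k).2.1, (hiter k).2.2]

include hB hΨ in
/-- **(T) THE ITERATES STAY IN THE BALL AND TEND TO `1`**: `Ψ^k u ∈ B` for all `k` and `Ψ^k u → 1` (`u ∈ B`, `‖s‖ < 1`, `ρ < 1`, `2 ≠ 0`).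
[cite: Rogawski1990, §8.1 (8.1.1) p. 116] [cite: HarishChandra1999AdmissibleDistributions, §3.1 Lemma 3.2] -/
theorem iterate_mem_tendsto_cayleyScaling (h2 : (2 : K) ≠ 0) (hs1 : ‖s‖ < 1) (hρ : ρ < 1) {u : ↥(unitaryGroupOfForm σ J)} (hu : u ∈ B) :
    (∀ k : ℕ, Ψ^[k] u ∈ B) ∧ Tendsto (fun k : ℕ => Ψ^[k] u) atTop (𝓝 1) :=
  ⟨fun k => (iterate_cayleyScaling σ J hB hΨ h2 hs1.le hρ hu k).1, tendsto_iterate_cayleyScaling_aux σ J hB hΨ h2 hs1 hρ hu⟩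

include hB hΨ in
/-- `Ψ` is continuous on `B`: `u ↦ (c(s•X_u), c(−s•X_u))` through `g ↦ (g, g⁻¹)` (★ FILE 1 continuity kit). [cite: PlatonovRapinchuk1994, §3.3] -/
private theorem continuousOn_cayleyScaling_aux (hsρ : ‖s‖ * ρ < 1) : ContinuousOn Ψ B := by
  intro u hu
  obtain ⟨hP, hm, hp⟩ := isUnit_of_mem_ball σ J hB hsρ hu
  have hm' : (1 - (-s) • ((((u : GL (Fin 2) K) : Matrix (Fin 2) (Fin 2) K) - 1) * (((u : GL (Fin 2) K) : Matrix (Fin 2) (Fin 2) K) + 1)⁻¹)).det ≠ 0 := by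
    rw [neg_smul, sub_neg_eq_add]; exact hp.ne_zero
  have hF1 := ((continuousAt_cayley_smul_inverseWindow s hP.ne_zero hm.ne_zero).tendsto).comp ((continuous_coe_mat σ J).tendsto u)
  have hF2 := (MulOpposite.continuous_op.tendsto _).comp
    (((continuousAt_cayley_smul_inverseWindow (-s) hP.ne_zero hm').tendsto).comp ((continuous_coe_mat σ J).tendsto u))
  have hF := (hF1.prodMk_nhds hF2).mono_left (nhdsWithin_le_nhds (s := B))
  have heq : ∀ u' ∈ B, Units.embedProduct (Matrix (Fin 2) (Fin 2) K) ((Ψ u' : ↥(unitaryGroupOfForm σ J)) : GL (Fin 2) K) =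
      (cayley (s • ((((u' : GL (Fin 2) K) : Matrix (Fin 2) (Fin 2) K) - 1) * (((u' : GL (Fin 2) K) : Matrix (Fin 2) (Fin 2) K) + 1)⁻¹)),
        MulOpposite.op (cayley ((-s) • ((((u' : GL (Fin 2) K) : Matrix (Fin 2) (Fin 2) K) - 1) * (((u' : GL (Fin 2) K) : Matrix (Fin 2) (Fin 2) K) + 1)⁻¹)))) :=
    fun u' hu' => by rw [Units.embedProduct_apply, (hΨ u' hu').1, (hΨ u' hu').2, neg_smul]
  rw [ContinuousWithinAt, tendsto_subtype_rng, Units.isEmbedding_embedProduct.isInducing.tendsto_nhds_iff, heq u hu]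
  refine hF.congr' ?_
  filter_upwards [self_mem_nhdsWithin] with u' hu'
  exact (heq u' hu').symm

include hB hΨ in
/-- **`Ψ|_B` IS CONTINUOUS** (the restriction of `Ψ` to the ball, `GL`-topology): `u ↦ (c(s•X_u), c(−s•X_u))` read through `g ↦ (g, g⁻¹)`. [cite: PlatonovRapinchuk1994, §3.3] -/
theorem continuous_restrict_cayleyScaling (hsρ : ‖s‖ * ρ < 1) : Continuous (B.restrict Ψ) :=
  continuousOn_iff_continuous_restrict.1 (continuousOn_cayleyScaling_aux σ J hB hΨ hsρ)

include hB hΨ in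
/-- **The `s⁻¹`-scaling inverts `Ψ` on `B`**: if `Θ` agrees with `c ∘ (s⁻¹·) ∘ c⁻¹` on a ball `B′` of radius `ρ′ ≥ ‖s‖ρ`, then `Θ(Ψ u) = u` for `u ∈ B`. [cite: PlatonovRapinchuk1994, §3.3] -/
theorem cayleyScaling_left_inv (h2 : (2 : K) ≠ 0) (hs0 : s ≠ 0) (hsρ : ‖s‖ * ρ < 1) {ρ' : ℝ} (hρ' : ‖s‖ * ρ ≤ ρ')
    {B' : Set ↥(unitaryGroupOfForm σ J)}
    (hB' : ∀ u : ↥(unitaryGroupOfForm σ J), u ∈ B' ↔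
      IsUnit (((u : GL (Fin 2) K) : Matrix (Fin 2) (Fin 2) K) + 1).det ∧
      ‖((((u : GL (Fin 2) K) : Matrix (Fin 2) (Fin 2) K) - 1) * (((u : GL (Fin 2) K) : Matrix (Fin 2) (Fin 2) K) + 1)⁻¹).trace‖ ≤ ρ' ∧
      ‖((((u : GL (Fin 2) K) : Matrix (Fin 2) (Fin 2) K) - 1) * (((u : GL (Fin 2) K) : Matrix (Fin 2) (Fin 2) K) + 1)⁻¹).det‖ ≤ ρ' ^ 2)
    {Θ : ↥(unitaryGroupOfForm σ J) → ↥(unitaryGroupOfForm σ J)}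
    (hΘ : ∀ u ∈ B',
      (((Θ u : ↥(unitaryGroupOfForm σ J)) : GL (Fin 2) K) : Matrix (Fin 2) (Fin 2) K) =
        cayley (s⁻¹ • ((((u : GL (Fin 2) K) : Matrix (Fin 2) (Fin 2) K) - 1) * (((u : GL (Fin 2) K) : Matrix (Fin 2) (Fin 2) K) + 1)⁻¹)))
    {u : ↥(unitaryGroupOfForm σ J)} (hu : u ∈ B) : Θ (Ψ u) = u := by
  have hmem : Ψ u ∈ B' := cayleyScaling_mem_of_ball σ J hB hΨ h2 hsρ hρ' hB' hu
  obtain ⟨hP, -, -⟩ := isUnit_of_mem_ball σ J hB hsρ hu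
  obtain ⟨-, hcay₀⟩ := cayley_inverseWindow (isUnit_iff_ne_zero.2 h2) hP
  obtain ⟨-, hX'⟩ := inverseWindow_cayleyScaling σ J hB hΨ h2 hsρ hu
  apply Subtype.ext; apply Units.ext
  rw [hΘ _ hmem, hX', smul_smul, inv_mul_cancel₀ hs0, one_smul, hcay₀]

include hB hΨ in
/-- **(S) `Ψ` PULLS `C_c^∞` BACK TO `C_c^∞` ON THE BALL**: for `F` locally constant with compact support, `1_B·(F ∘ Ψ)` is locally constant (`B` clopen, `Ψ|_B` continuous) and
compactly supported (support inside `Θ(tsupp F ∩ B′)`, `B′` the closed ball of radius `‖s‖ρ`, `Θ` the `s⁻¹`-scaling; `2 ≠ 0`, `0 < ‖s‖ ≤ 1`, `0 < ρ < 1`). [cite: Rogawski1990, §8.1 Prop. 8.1.2 (b) p. 114] -/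
theorem isLocSmooth_indicator_comp_cayleyScaling (h2 : (2 : K) ≠ 0) (hs0 : s ≠ 0) (hs1 : ‖s‖ ≤ 1) (hρ0 : 0 < ρ) (hρ1 : ρ < 1)
    {B' : Set ↥(unitaryGroupOfForm σ J)}
    (hB' : ∀ u : ↥(unitaryGroupOfForm σ J), u ∈ B' ↔
      IsUnit (((u : GL (Fin 2) K) : Matrix (Fin 2) (Fin 2) K) + 1).det ∧
      ‖((((u : GL (Fin 2) K) : Matrix (Fin 2) (Fin 2) K) - 1) * (((u : GL (Fin 2) K) : Matrix (Fin 2) (Fin 2) K) + 1)⁻¹).trace‖ ≤ ‖s‖ * ρ ∧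
      ‖((((u : GL (Fin 2) K) : Matrix (Fin 2) (Fin 2) K) - 1) * (((u : GL (Fin 2) K) : Matrix (Fin 2) (Fin 2) K) + 1)⁻¹).det‖ ≤ (‖s‖ * ρ) ^ 2)
    {Θ : ↥(unitaryGroupOfForm σ J) → ↥(unitaryGroupOfForm σ J)}
    (hΘ : ∀ u ∈ B',
      (((Θ u : ↥(unitaryGroupOfForm σ J)) : GL (Fin 2) K) : Matrix (Fin 2) (Fin 2) K) =
          cayley (s⁻¹ • ((((u : GL (Fin 2) K) : Matrix (Fin 2) (Fin 2) K) - 1) * (((u : GL (Fin 2) K) : Matrix (Fin 2) (Fin 2) K) + 1)⁻¹)) ∧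
      ((((Θ u : ↥(unitaryGroupOfForm σ J)) : GL (Fin 2) K)⁻¹ : GL (Fin 2) K) : Matrix (Fin 2) (Fin 2) K) =
          cayley (-(s⁻¹ • ((((u : GL (Fin 2) K) : Matrix (Fin 2) (Fin 2) K) - 1) * (((u : GL (Fin 2) K) : Matrix (Fin 2) (Fin 2) K) + 1)⁻¹))))
    {F : ↥(unitaryGroupOfForm σ J) → ℂ} (hF : IsLocSmooth F) : IsLocSmooth (B.indicator (F ∘ Ψ)) := by
  have hρ0' : 0 ≤ ρ := hρ0.le
  have hsρ : ‖s‖ * ρ < 1 := lt_of_le_of_lt (mul_le_of_le_one_left hρ0' hs1) hρ1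
  have hsρ0 : 0 < ‖s‖ * ρ := mul_pos (norm_pos_iff.2 hs0) hρ0
  have hsρ' : ‖s⁻¹‖ * (‖s‖ * ρ) < 1 := by rwa [norm_inv, ← mul_assoc, inv_mul_cancel₀ (norm_ne_zero_iff.2 hs0), one_mul]
  have hBo : IsOpen B := (ball_isClopen σ J hB hρ0 hρ1 h2).2
  have hBc : IsClosed B := (ball_isClopen σ J hB hρ0 hρ1 h2).1
  have hB'c : IsClosed B' := (ball_isClopen σ J hB' hsρ0 hsρ h2).1
  have hΨc : ContinuousOn Ψ B := continuousOn_cayleyScaling_aux σ J hB hΨ hsρ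
  have hΘc : ContinuousOn Θ B' := continuousOn_cayleyScaling_aux σ J hB' hΘ hsρ'
  have hlinv : ∀ u ∈ B, Θ (Ψ u) = u := fun u hu => cayleyScaling_left_inv σ J hB hΨ h2 hs0 hsρ le_rfl hB' (fun u' hu' => (hΘ u' hu').1) hu
  refine ⟨?_, ?_⟩
  · rw [IsLocallyConstant.iff_eventually_eq]  -- locally constant
    intro u
    by_cases hu : u ∈ B
    · have hV : ∀ᶠ y in 𝓝 (Ψ u), F y = F (Ψ u) := (hF.1.isOpen_fiber (F (Ψ u))).mem_nhds rfl
      have h1 : ∀ᶠ u' in 𝓝[B] u, F (Ψ u') = F (Ψ u) := (hΨc u hu).eventually hV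
      rw [hBo.nhdsWithin_eq hu] at h1
      filter_upwards [h1, hBo.mem_nhds hu] with u' h1' h2'
      rw [indicator_of_mem h2', indicator_of_mem hu]
      exact h1'
    · filter_upwards [hBc.isOpen_compl.mem_nhds hu] with u' h
      rw [indicator_of_notMem h, indicator_of_notMem hu]
  · have hK : IsCompact (Θ '' (tsupport F ∩ B')) := (hF.2.inter_right hB'c).image_of_continuousOn (hΘc.mono inter_subset_right)
    refine HasCompactSupport.intro hK fun u hu => ?_
    by_contra hne
    have huB : u ∈ B := by
      by_contra h
      exact hne (indicator_of_notMem h _)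
    rw [indicator_of_mem huB] at hne
    exact hu ⟨Ψ u, ⟨subset_tsupport _ hne, cayleyScaling_mem_of_ball σ J hB hΨ h2 hsρ le_rfl hB' huB⟩, hlinv u huB⟩

end Model

end Summit.HodgeConjecture.HodgeConjecture.Cruxes.H413.K2E3CayleyScalingRankOneMap

end
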